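import Mathlib
import HarnessLib
import Summits.NavierStokesRegularity.NavierStokesRegularity.Theorems.UnthreadedDoorNetFluxSphericalExtremumLaplacian
import Summits.NavierStokesRegularity.NavierStokesRegularity.Theorems.UnthreadedDoorNetFluxSecondDifferenceIntegral
import Summits.NavierStokesRegularity.NavierStokesRegularity.Theorems.UnthreadedDoorNetFluxViscosityDefs
import Summits.NavierStokesRegularity.NavierStokesRegularity.Theorems.UnthreadedDoorNetFluxNearCentreFlux

/-!
# Route `UnthreadedDoor`, crux `PoloidalLiouville` (stmt-NavierStokesRegularity-1222), WALL W1 `stub_scalarLiouville` —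
# crux idea «netflux-typei-gap» (ns-idea-14, LINE v7 0e37b0e5ff94): NF-1cᵛ `stub_oneSidedLaw_of_hinges` — CALCULUS BRICKS

The line's NF-1cᵛ stub `stub_oneSidedLaw_of_hinges : EnvelopeFacts → ExtremalHeadEMF → OneSidedNetFluxLaw` is proved in
`…UnthreadedDoorNetFluxOneSidedLaw` following the Lines docstring «Derivation of (L)».  This file holds the PDE-free calculus it
needs, in the line's vocabulary (`sphSup`, `sphInf`, `netFlux`, `sphArgmax`, `sphArgmin`, `radDeriv`):

* `contDiffOn_laplacian_of_isOpen`, `contDiffOn_gradient_of_isOpen_compl` — `Δf`, `∇f` are smooth where `f` is (open set);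
* `contDiffOn_windowOperator`, `contDiff_radialMomentum` — the frozen-time operator `z ↦ ∂ₜT + ⟪v, ∇T⟫ − ΔT` is `C¹` off the centre and
  `z ↦ ⟪v(t,z), z − x₀⟫` is `C¹` (the regularity `CapSym.headPotentialExists` asks for);
* `cross_sub_smul_eq_zero_of_head` — the head relation `L·(x − x₀) = m ∇T − ∇P` gives the TANGENTIAL relation `(∇P − m∇T) × (x − x₀) = 0`
  (the hypothesis of `ExtremalHeadEMF`);
* `exists_time_taylor_bound` — **Taylor in time with a NAMED uniform constant** (card v5.2 P1): on `[t − δ₀, t] × {a ≤ ‖x − x₀‖ ≤ R}`,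
  `|T(t,x) − T(s,x) − (t − s)∂ₜT(t,x)| ≤ M₂ (t − s)²`, `M₂ = sup |∂ₜ²T|` over that compact (two mean-value steps);
* `continuousOn_radDeriv_of_contDiffOn`, `exists_mem_sphArgmax_sSup_eq`, `exists_mem_sphArgmin_sInf_eq` — `∂_r P` is continuous off
  `x₀` for `P ∈ C¹`, so its `sup` over the compact `argmax_{S_r}T` and its `inf` over `argmin_{S_r}T` are ATTAINED (the extremisers
  the derivation chooses);
* `continuousOn_netFlux_family`, `continuousOn_netFlux_slice`, `exists_oneSided_deriv_netFlux` — joint continuity of `w = netFlux` and its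
  one-sided `r`-derivatives `ℓm ≤ ℓp` (difference of the semiconvex `ρ·sphSup` and the semiconcave `ρ·sphInf`, p664847);
* `integral_Ioo_eq_intervalIntegral_of_le`, `integral_Ioo_deriv_eq_sub_of_lipschitzOnWith` — bookkeeping: `∫_{(a,R)} = ∫_a^R`, and the
  fundamental theorem of calculus for the LIPSCHITZ extremal head difference `I(t,·)` (Mathlib: Lipschitz ⇒ absolutely continuous ⇒
  `∫_a^R I' = I(R) − I(a)`).

WHAT THIS IS NOT: no NS-regularity statement is touched (frozen-time calculus); SUPPORT for the line's NF-1cᵛ stub; `PoloidalLiouville`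
(1222), W1, the line's rung target and the summit stay OPEN.  `--supports stmt-NavierStokesRegularity-1222 --as helper`.  [folklore]
-/

noncomputable section

-- the summit and its single sub-problem share the name (CONVENTIONS §1)
set_option linter.dupNamespace false

open Set Function Filter Topology InnerProductSpace MeasureTheory
open scoped RealInnerProductSpace ContDiff NNReal

namespace Summit.NavierStokesRegularity.NavierStokesRegularity.Theorems.PoloidalLiouville.NetFlux

open Literature.Analysis Literature.Analysis.FluidPDE

variable {v : ℝ → E3 → E3} {T : ℝ → E3 → ℝ} {x₀ : E3} {t₀ : ℝ}

/-! ### Smoothness of the Laplacian and the gradient on an open set -/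

/-- **The Laplacian of a function smooth on an open set is smooth there** (`Δf = Σᵢ D²f[eᵢ,eᵢ]` in an orthonormal basis). [folklore] -/
theorem contDiffOn_laplacian_of_isOpen {U : Set E3} (hU : IsOpen U) {f : E3 → ℝ} (hf : ContDiffOn ℝ (⊤ : ℕ∞) f U) :
    ContDiffOn ℝ (⊤ : ℕ∞) (fun x => Laplacian.laplacian f x) U := by
  have hf1 : ContDiffOn ℝ (⊤ : ℕ∞) (fderiv ℝ f) U := hf.fderiv_of_isOpen hU (by simp)
  have hf2 : ContDiffOn ℝ (⊤ : ℕ∞) (fderiv ℝ (fderiv ℝ f)) U := hf1.fderiv_of_isOpen hU (by simp)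
  set b := stdOrthonormalBasis ℝ E3 with hb
  have hΔ := InnerProductSpace.laplacian_eq_iteratedFDeriv_orthonormalBasis f b
  have e : (fun x => Laplacian.laplacian f x) = fun x => ∑ i, fderiv ℝ (fderiv ℝ f) x (b i) (b i) := by
    funext x
    have h := congrFun hΔ x
    simp only [iteratedFDeriv_two_apply, Matrix.cons_val_zero, Matrix.cons_val_one] at h
    exact h
  rw [e]
  exact ContDiffOn.sum fun i _ => (hf2.clm_apply contDiffOn_const).clm_apply contDiffOn_const

/-- **The gradient of a function smooth on an open set is smooth there** (`∇f = (toDual)⁻¹ ∘ Df`). [folklore] -/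
theorem contDiffOn_gradient_of_isOpen_compl {U : Set E3} (hU : IsOpen U) {f : E3 → ℝ} (hf : ContDiffOn ℝ (⊤ : ℕ∞) f U) :
    ContDiffOn ℝ (⊤ : ℕ∞) (fun x => gradient f x) U := by
  have hD : ContDiffOn ℝ (⊤ : ℕ∞) (fderiv ℝ f) U := hf.fderiv_of_isOpen hU (by simp)
  have h := (InnerProductSpace.toDual ℝ E3).symm.toContinuousLinearEquiv.contDiff.comp_contDiffOn hD
  exact h.congr fun x _ => rfl

/-! ### Regularity of the frozen-time operator and of the radial momentum -/

/-- **The frozen-time operator `z ↦ ∂ₜT(t,z) + ⟪v(t,z), ∇T(t,z)⟫ − ΔT(t,z)` is `C¹` off the centre** for `v` smooth on the window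
and `T` smooth on the window off the centre (the function whose gradient enters `CurledLaw`). [folklore] -/
theorem contDiffOn_windowOperator (hv : ContDiffOn ℝ (⊤ : ℕ∞) (uncurry v) (Ioo t₀ 0 ×ˢ (univ : Set E3)))
    (hT : ContDiffOn ℝ (⊤ : ℕ∞) (uncurry T) (Ioo t₀ 0 ×ˢ ({x₀}ᶜ : Set E3))) {t : ℝ} (ht : t ∈ Ioo t₀ 0) :
    ContDiffOn ℝ 1 (fun z => deriv (fun s => T s z) t + ⟪v t z, gradient (T t) z⟫ - Laplacian.laplacian (T t) z)
      ({x₀}ᶜ : Set E3) := by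
  have hO : IsOpen ({x₀}ᶜ : Set E3) := isOpen_compl_singleton
  have hW : IsOpen (Ioo t₀ 0 ×ˢ ({x₀}ᶜ : Set E3)) := isOpen_Ioo.prod hO
  have hTt : ContDiffOn ℝ (⊤ : ℕ∞) (T t) ({x₀}ᶜ) := contDiffOn_slice_compl hT ht
  -- the time derivative
  have hT₁ := (contDiffOn_deriv_tslice hW hT).2
  have h1 : ContDiffOn ℝ (⊤ : ℕ∞) (fun z : E3 => deriv (fun s => T s z) t) ({x₀}ᶜ) := by
    have hc : ContDiffOn ℝ (⊤ : ℕ∞) (fun z : E3 => ((t, z) : ℝ × E3)) ({x₀}ᶜ) :=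
      (contDiffOn_const.prodMk contDiffOn_id)
    have h := hT₁.comp hc fun z hz => ⟨ht, hz⟩
    exact h.congr fun z _ => rfl
  -- the transport term
  have hvt : ContDiff ℝ (⊤ : ℕ∞) (v t) := contDiff_slice_of_window hv ht
  have h2 : ContDiffOn ℝ (⊤ : ℕ∞) (fun z : E3 => ⟪v t z, gradient (T t) z⟫) ({x₀}ᶜ) :=
    hvt.contDiffOn.inner ℝ (contDiffOn_gradient_of_isOpen_compl hO hTt)
  -- the Laplacian
  have h3 : ContDiffOn ℝ (⊤ : ℕ∞) (fun z : E3 => Laplacian.laplacian (T t) z) ({x₀}ᶜ) :=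
    contDiffOn_laplacian_of_isOpen hO hTt
  exact ((h1.add h2).sub h3).of_le (by exact_mod_cast le_top)

/-- **The radial momentum `z ↦ ⟪v(t,z), z − x₀⟫` is `C¹`** for `v` smooth on the window. [folklore] -/
theorem contDiff_radialMomentum (hv : ContDiffOn ℝ (⊤ : ℕ∞) (uncurry v) (Ioo t₀ 0 ×ˢ (univ : Set E3))) {t : ℝ}
    (ht : t ∈ Ioo t₀ 0) (x₀ : E3) : ContDiffOn ℝ 1 (fun z : E3 => ⟪v t z, z - x₀⟫) ({x₀}ᶜ : Set E3) := by
  have hvt : ContDiff ℝ (⊤ : ℕ∞) (v t) := contDiff_slice_of_window hv ht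
  have h : ContDiff ℝ (⊤ : ℕ∞) (fun z : E3 => ⟪v t z, z - x₀⟫) := hvt.inner ℝ (contDiff_id.sub contDiff_const)
  exact (h.of_le (by exact_mod_cast le_top)).contDiffOn

/-- Time slices of `T` are `C²` off the centre. [folklore] -/
theorem contDiffOn_two_slice_compl (hT : ContDiffOn ℝ (⊤ : ℕ∞) (uncurry T) (Ioo t₀ 0 ×ˢ ({x₀}ᶜ : Set E3))) {t : ℝ}
    (ht : t ∈ Ioo t₀ 0) : ContDiffOn ℝ 2 (T t) ({x₀}ᶜ : Set E3) :=
  (contDiffOn_slice_compl hT ht).of_le (WithTop.coe_le_coe.2 le_top)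

/-! ### The tangential relation from the head relation -/

/-- **Head relation ⇒ tangential relation**: if `L·y = m·g − p` then `(p − m·g) × y = 0` (with `y = x − x₀`, `g = ∇T(x)`, `p = ∇P(x)`
this turns the conclusion of `CapSym.headPotentialExists` into the hypothesis of `ExtremalHeadEMF`). [folklore] -/
theorem cross_sub_smul_eq_zero_of_head {L m : ℝ} {y g p : E3} (h : L • y = m • g - p) : cross (p - m • g) y = 0 := by
  have e : p - m • g = (-L) • y := by rw [neg_smul, h]; abel
  rw [e]
  -- `(c · y) × y = 0` (cf. `cross_smul_self` in `…NetFluxStratumReduction`, not imported here to stay off its import cone)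
  simp only [cross, WithLp.ofLp_smul, LinearMap.map_smul, LinearMap.smul_apply, cross_self, smul_zero,
    WithLp.toLp_zero]

/-! ### Taylor in time with a named uniform constant -/

/-- **Taylor in time, uniformly on a shell** (card v5.2 P1: the remainder constant is NAMED and uniform): for `T` smooth on
`]t₀,0[ × (ℝ³ ∖ {x₀})`, `t ∈ ]t₀,0[` and `0 < a`, there are `δ₀ > 0` (with `t₀ < t − δ₀`) and `M₂ ≥ 0` — a bound of `|∂ₜ²T|` on the
compact `[t − δ₀, t] × {a ≤ ‖x − x₀‖ ≤ R}` — such that `|T(t,x) − T(s,x) − (t − s)·∂ₜT(t,x)| ≤ M₂ (t − s)²` for all `s ∈ [t − δ₀, t]`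
and all `x` in the shell (mean value theorem twice). [folklore] -/
theorem exists_time_taylor_bound (hT : ContDiffOn ℝ (⊤ : ℕ∞) (uncurry T) (Ioo t₀ 0 ×ˢ ({x₀}ᶜ : Set E3))) {t : ℝ}
    (ht : t ∈ Ioo t₀ 0) {a : ℝ} (ha : 0 < a) (R : ℝ) :
    ∃ δ₀ M₂ : ℝ, 0 < δ₀ ∧ t₀ < t - δ₀ ∧ 0 ≤ M₂ ∧
      ∀ s ∈ Icc (t - δ₀) t, ∀ x : E3, ‖x - x₀‖ ∈ Icc a R →
        |T t x - T s x - (t - s) * deriv (fun σ => T σ x) t| ≤ M₂ * (t - s) ^ 2 := by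
  set W : Set (ℝ × E3) := Ioo t₀ 0 ×ˢ ({x₀}ᶜ : Set E3) with hWdef
  have hW : IsOpen W := isOpen_Ioo.prod isOpen_compl_singleton
  -- first and second time derivatives as smooth functions on the window
  set T₁ : ℝ × E3 → ℝ := fun q => deriv (fun s => uncurry T (s, q.2)) q.1 with hT₁def
  have hT₁ : ContDiffOn ℝ (⊤ : ℕ∞) T₁ W := (contDiffOn_deriv_tslice hW hT).2
  set T₂ : ℝ × E3 → ℝ := fun q => deriv (fun s => T₁ (s, q.2)) q.1 with hT₂def
  have hT₂ : ContDiffOn ℝ (⊤ : ℕ∞) T₂ W := (contDiffOn_deriv_tslice hW hT₁).2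
  -- the compact `[t − δ₀, t] × shell`
  set δ₀ : ℝ := (t - t₀) / 2 with hδ₀
  have hδ₀pos : 0 < δ₀ := by rw [hδ₀]; linarith [ht.1]
  have htδ : t₀ < t - δ₀ := by rw [hδ₀]; linarith [ht.1]
  set Sh : Set E3 := {y : E3 | ‖y - x₀‖ ∈ Icc a R} with hSh
  have hK : IsCompact (Icc (t - δ₀) t ×ˢ Sh) := isCompact_Icc.prod (isCompact_shell x₀ a R)
  have hIcc : Icc (t - δ₀) t ⊆ Ioo t₀ 0 := fun s hs => ⟨htδ.trans_le hs.1, lt_of_le_of_lt hs.2 ht.2⟩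
  have hShO : Sh ⊆ ({x₀}ᶜ : Set E3) := fun y hy h0 => by
    rw [mem_singleton_iff] at h0
    have : ‖y - x₀‖ = 0 := by rw [h0, sub_self, norm_zero]
    linarith [hy.1]
  have hKW : Icc (t - δ₀) t ×ˢ Sh ⊆ W := fun q hq => ⟨hIcc hq.1, hShO hq.2⟩
  obtain ⟨M₀, hM₀⟩ := hK.exists_bound_of_continuousOn (hT₂.continuousOn.mono hKW)
  set M₂ : ℝ := max M₀ 0 with hM₂
  have hM₂0 : 0 ≤ M₂ := le_max_right _ _
  refine ⟨δ₀, M₂, hδ₀pos, htδ, hM₂0, fun s hs x hx => ?_⟩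
  have hxO : x ∈ ({x₀}ᶜ : Set E3) := hShO hx
  -- the time slices through `x` and their derivatives
  have hd0 : ∀ σ ∈ Ioo t₀ 0, HasDerivAt (fun σ' => T σ' x) (T₁ (σ, x)) σ := by
    intro σ hσ
    have hq : ((σ, x) : ℝ × E3) ∈ W := ⟨hσ, hxO⟩
    have hd : DifferentiableAt ℝ (uncurry T) (σ, x) :=
      (hT.differentiableOn (by simp) _ hq).differentiableAt (hW.mem_nhds hq)
    have e : (fun σ' : ℝ => T σ' x) = uncurry T ∘ fun σ' => (σ', x) := rfl
    have h1 : DifferentiableAt ℝ (fun σ' : ℝ => T σ' x) σ := by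
      rw [e]; exact hd.comp σ (differentiableAt_id.prodMk (differentiableAt_const x))
    exact h1.hasDerivAt
  have hd1 : ∀ σ ∈ Ioo t₀ 0, HasDerivAt (fun σ' => T₁ (σ', x)) (T₂ (σ, x)) σ := by
    intro σ hσ
    have hq : ((σ, x) : ℝ × E3) ∈ W := ⟨hσ, hxO⟩
    have hd : DifferentiableAt ℝ T₁ (σ, x) :=
      (hT₁.differentiableOn (by simp) _ hq).differentiableAt (hW.mem_nhds hq)
    have e : (fun σ' : ℝ => T₁ (σ', x)) = T₁ ∘ fun σ' => (σ', x) := rfl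
    have h1 : DifferentiableAt ℝ (fun σ' : ℝ => T₁ (σ', x)) σ := by
      rw [e]; exact hd.comp σ (differentiableAt_id.prodMk (differentiableAt_const x))
    exact h1.hasDerivAt
  have hderiv_t : deriv (fun σ => T σ x) t = T₁ (t, x) := (hd0 t ht).deriv
  -- `|T₁(σ,x) − T₁(t,x)| ≤ M₂ (t − s)` for `σ ∈ [s, t]`
  have hst : Icc s t ⊆ Icc (t - δ₀) t := Icc_subset_Icc hs.1 le_rfl
  have hts : 0 ≤ t - s := by linarith [hs.2]
  have hb1 : ∀ σ ∈ Icc s t, ‖T₁ (σ, x) - T₁ (t, x)‖ ≤ M₂ * (t - s) := by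
    intro σ hσ
    have h := (convex_Icc s t).norm_image_sub_le_of_norm_hasDerivWithin_le
      (f := fun σ' => T₁ (σ', x)) (f' := fun σ' => T₂ (σ', x))
      (fun σ' hσ' => (hd1 σ' (hIcc (hst hσ'))).hasDerivWithinAt)
      (fun σ' hσ' => (hM₀ (σ', x) ⟨hst hσ', hx⟩).trans (le_max_left M₀ 0))
      (right_mem_Icc.2 hs.2) hσ
    rw [Real.norm_eq_abs] at h ⊢
    calc |T₁ (σ, x) - T₁ (t, x)| ≤ M₂ * ‖σ - t‖ := h
      _ ≤ M₂ * (t - s) := by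
          refine mul_le_mul_of_nonneg_left ?_ hM₂0
          rw [Real.norm_eq_abs, abs_sub_comm, abs_of_nonneg (by linarith [hσ.2])]
          linarith [hσ.1]
  -- integrate once more: `ψ(σ) = T(σ,x) − σ T₁(t,x)`
  have hψ : ∀ σ ∈ Icc s t,
      HasDerivWithinAt (fun σ' => T σ' x - σ' * T₁ (t, x)) (T₁ (σ, x) - T₁ (t, x)) (Icc s t) σ := by
    intro σ hσ
    have h1 := (hd0 σ (hIcc (hst hσ))).hasDerivWithinAt (s := Icc s t)
    have h2 : HasDerivWithinAt (fun σ' : ℝ => σ' * T₁ (t, x)) (1 * T₁ (t, x)) (Icc s t) σ :=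
      (hasDerivWithinAt_id σ _).mul_const _
    have h := h1.sub h2
    rwa [one_mul] at h
  have h := (convex_Icc s t).norm_image_sub_le_of_norm_hasDerivWithin_le hψ hb1
    (left_mem_Icc.2 hs.2) (right_mem_Icc.2 hs.2)
  rw [Real.norm_eq_abs, Real.norm_eq_abs, abs_of_nonneg hts] at h
  rw [hderiv_t]
  have e : T t x - T s x - (t - s) * T₁ (t, x) = T t x - t * T₁ (t, x) - (T s x - s * T₁ (t, x)) := by ring
  rw [e, pow_two, ← mul_assoc]
  exact h

/-! ### Extremisers attaining `sup ∂_rP` over the argmax and `inf ∂_rP` over the argmin -/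

/-- **`∂_r P` is continuous off the centre** for `P ∈ C¹(ℝ³ ∖ {x₀})` (`∂_rP(x) = DP(x)[u(x)]`, `u` the unit radial vector). [folklore] -/
theorem continuousOn_radDeriv_of_contDiffOn {P : E3 → ℝ} (hP : ContDiffOn ℝ 1 P ({x₀}ᶜ : Set E3)) :
    ContinuousOn (radDeriv P x₀) ({x₀}ᶜ : Set E3) := by
  have hO : IsOpen ({x₀}ᶜ : Set E3) := isOpen_compl_singleton
  have hD : ContinuousOn (fun x => fderiv ℝ P x) ({x₀}ᶜ) := hP.continuousOn_fderiv_of_isOpen hO le_rfl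
  have h : ContinuousOn (fun x => fderiv ℝ P x (‖x - x₀‖⁻¹ • (x - x₀))) ({x₀}ᶜ) :=
    hD.clm_apply (continuousOn_radialUnit x₀)
  refine h.congr fun x hx => ?_
  have hPd : DifferentiableAt ℝ P x := (hP.differentiableOn one_ne_zero x hx).differentiableAt (hO.mem_nhds hx)
  exact radDeriv_eq_fderiv hx hPd

/-- **A `sup` over the spherical argmax is attained**: for `r > 0`, `f, g` continuous off `x₀`, there is `x ∈ argmax_{S_r(x₀)} f` with
`sSup (g '' argmax) = g x`, and the image is bounded above (compactness of the argmax). [folklore] -/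
theorem exists_mem_sphArgmax_sSup_eq {f g : E3 → ℝ} {x₀ : E3} {r : ℝ} (hr : 0 < r) (hf : ContinuousOn f ({x₀}ᶜ))
    (hg : ContinuousOn g ({x₀}ᶜ)) :
    (∃ x ∈ sphArgmax f x₀ r, sSup (g '' sphArgmax f x₀ r) = g x) ∧ BddAbove (g '' sphArgmax f x₀ r) := by
  have hfS : ContinuousOn f (Metric.sphere x₀ r) := continuousOn_sphere_of_continuousOn_compl hf hr
  have hK : IsCompact (sphArgmax f x₀ r) := isCompact_sphArgmax hfS
  have hne : (sphArgmax f x₀ r).Nonempty := exists_mem_sphArgmax hfS hr.le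
  have hgK : ContinuousOn g (sphArgmax f x₀ r) := hg.mono fun x hx => ne_center_of_mem_sphere hr hx.1
  have hbdd : BddAbove (g '' sphArgmax f x₀ r) := hK.bddAbove_image hgK
  refine ⟨?_, hbdd⟩
  obtain ⟨x, hx, hmax⟩ := hK.exists_isMaxOn hne hgK
  refine ⟨x, hx, le_antisymm (csSup_le (hne.image _) ?_) (le_csSup hbdd ⟨x, hx, rfl⟩)⟩
  rintro _ ⟨y, hy, rfl⟩
  exact hmax hy

/-- **An `inf` over the spherical argmin is attained**: for `r > 0`, `f, g` continuous off `x₀`, there is `x ∈ argmin_{S_r(x₀)} f` with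
`sInf (g '' argmin) = g x`, and the image is bounded below. [folklore] -/
theorem exists_mem_sphArgmin_sInf_eq {f g : E3 → ℝ} {x₀ : E3} {r : ℝ} (hr : 0 < r) (hf : ContinuousOn f ({x₀}ᶜ))
    (hg : ContinuousOn g ({x₀}ᶜ)) :
    (∃ x ∈ sphArgmin f x₀ r, sInf (g '' sphArgmin f x₀ r) = g x) ∧ BddBelow (g '' sphArgmin f x₀ r) := by
  rw [sphArgmin_eq_sphArgmax_neg]
  obtain ⟨h1, -, h3⟩ := exists_mem_sphArgmax_sInf_eq (f := fun y => -f y) hr hf.neg hg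
  exact ⟨h1, h3⟩

/-! ### The net flux density: joint continuity, slices, one-sided derivatives -/

/-- **`(t,r) ↦ w(t,r) = netFlux (T t) x₀ r` is jointly continuous on `]t₀,0[ × ]0,∞[`** for `T` continuous off the centre. [folklore] -/
theorem continuousOn_netFlux_family (hT : ContinuousOn (uncurry T) (Ioo t₀ 0 ×ˢ ({x₀}ᶜ : Set E3))) :
    ContinuousOn (fun p : ℝ × ℝ => netFlux (T p.1) x₀ p.2) (Ioo t₀ 0 ×ˢ Ioi 0) := by
  have h := continuous_snd.continuousOn.mul ((continuousOn_sphSup_family hT).sub (continuousOn_sphInf_family hT))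
  exact h.congr fun p _ => rfl

/-- **The slice `r ↦ w(t,r)` is continuous on `]0,∞[`** for `t` in the window. [folklore] -/
theorem continuousOn_netFlux_slice (hT : ContinuousOn (uncurry T) (Ioo t₀ 0 ×ˢ ({x₀}ᶜ : Set E3))) {t : ℝ}
    (ht : t ∈ Ioo t₀ 0) : ContinuousOn (fun ρ => netFlux (T t) x₀ ρ) (Ioi 0) := by
  have h := (continuousOn_netFlux_family hT).comp (Continuous.prodMk_right t).continuousOn fun ρ hρ => ⟨ht, hρ⟩
  exact h.congr fun ρ _ => rfl

/-- **One-sided `r`-derivatives of the net flux density, ordered `ℓm ≤ ℓp`**: `w = ρ·sphSup − ρ·sphInf` is the difference of a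
semiconvex and a semiconcave function (p664847). [folklore] -/
theorem exists_oneSided_deriv_netFlux (hT : ContDiffOn ℝ (⊤ : ℕ∞) (uncurry T) (Ioo t₀ 0 ×ˢ ({x₀}ᶜ : Set E3)))
    {t : ℝ} (ht : t ∈ Ioo t₀ 0) {r : ℝ} (hr : 0 < r) :
    ∃ lp lm : ℝ, HasDerivWithinAt (fun ρ => netFlux (T t) x₀ ρ) lp (Ioi r) r ∧
      HasDerivWithinAt (fun ρ => netFlux (T t) x₀ ρ) lm (Iio r) r ∧ lm ≤ lp := by
  obtain ⟨dp, dm, hp, hm, hle⟩ := exists_oneSided_deriv_rsphSup hT ht hr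
  obtain ⟨dp', dm', hp', hm', hle'⟩ := exists_oneSided_deriv_rsphInf hT ht hr
  have e : (fun ρ => netFlux (T t) x₀ ρ) = fun ρ => ρ * sphSup (T t) x₀ ρ - ρ * sphInf (T t) x₀ ρ := by
    funext ρ; unfold netFlux sphOsc; ring
  refine ⟨dp - dp', dm - dm', ?_, ?_, by linarith⟩
  · rw [e]; exact hp.sub hp'
  · rw [e]; exact hm.sub hm'

/-! ### Integral bookkeeping -/

/-- `∫_{(a,R)} f = ∫_a^R f` for `a ≤ R` (Lebesgue measure has no atoms). [folklore] -/
theorem integral_Ioo_eq_intervalIntegral_of_le {a R : ℝ} (haR : a ≤ R) (f : ℝ → ℝ) :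
    ∫ r in Ioo a R, f r = ∫ r in a..R, f r := by
  rw [intervalIntegral.integral_of_le haR, integral_Ioc_eq_integral_Ioo]

/-- **Fundamental theorem of calculus for a Lipschitz function on `[a,R]`**: `∫_{(a,R)} I' = I(R) − I(a)` and `I'` is integrable
there (Lipschitz ⇒ absolutely continuous, Mathlib's `AbsolutelyContinuousOnInterval.integral_deriv_eq_sub`). [folklore] -/
theorem integral_Ioo_deriv_eq_sub_of_lipschitzOnWith {I : ℝ → ℝ} {a R : ℝ} {L : ℝ≥0} (haR : a ≤ R)
    (hI : LipschitzOnWith L I (Icc a R)) :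
    (∫ r in Ioo a R, deriv I r) = I R - I a ∧ IntegrableOn (deriv I) (Ioo a R) := by
  have hI' : LipschitzOnWith L I (uIcc a R) := by rwa [uIcc_of_le haR]
  have hAC : AbsolutelyContinuousOnInterval I a R := hI'.absolutelyContinuousOnInterval
  refine ⟨?_, (intervalIntegrable_iff_integrableOn_Ioo_of_le haR).1 hAC.intervalIntegrable_deriv⟩
  rw [integral_Ioo_eq_intervalIntegral_of_le haR]
  exact hAC.integral_deriv_eq_sub

/-- A function continuous on `]0,∞[` is integrable on `(a,R)` for `0 < a`. [folklore] -/
theorem integrableOn_Ioo_of_continuousOn_Ioi {w : ℝ → ℝ} (hw : ContinuousOn w (Ioi 0)) {a R : ℝ} (ha : 0 < a) :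
    IntegrableOn w (Ioo a R) := by
  have h : IntegrableOn w (Icc a R) := (hw.mono fun r hr => ha.trans_le hr.1).integrableOn_Icc
  exact h.mono_set Ioo_subset_Icc_self

end Summit.NavierStokesRegularity.NavierStokesRegularity.Theorems.PoloidalLiouville.NetFlux

end
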